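import Literature.AlgebraicGeometry.Frobenioids.PadicFieldwiseSaturatedTemperedBase
import Literature.AlgebraicGeometry.Frobenioids.PadicFieldwiseSaturatedTransportEquiv
import HarnessLib

/-!
# Frobenioids II, Theorem 2.4 (i), proof p. 20 ll. 21–28: «Thus, `Φ₁` is fieldwise saturated if and only if `Φ₂` is» —
# the hypothesis `hfs` of the Thm 2.4 (i) assembly with NO base binders, over the printed §2 bases

Mochizuki, *The geometry of Frobenioids II*, Kyushu J. Math. **62** (2008) 401–460, §2, proof of Theorem 2.4 (i),
p. 417 (= p. 20 of the author's text) ll. 21–28 [cite: MochizukiFrdII2008, Thm 2.4 (i) p.20]: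

> "Moreover, since `Cᵢ` is a Frobenioid of rationally standard type … over a slim base category …, it follows from
> [Mzk5], Corollaries 4.10; 4.11, (ii), (iii), that `Ψ` induces a 1-compatible equivalence of categories
> `Ψ^Base : D₁ ⥲ D₂`, as well as compatible isomorphisms of functors `Φ₁ ⥲ Φ₂`, `B₁ ⥲ B₂` … hence that these conditions
> (a), (b) are preserved by `Ψ`. Thus, `Φ₁` is fieldwise saturated if and only if `Φ₂` is."

PROOF-ONLY file (abc-iut cell, seat abc-iut-w5-d229; SUBDAG-FrdII-Thm24 rows **W12-L01b/L03**; no definitions). The seat's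
`PadicFieldwiseSaturatedTransportEquiv.lean` proved «`Φ₁` FS ⟺ `Φ₂` FS» from the [FrdI] Cor. 4.10/4.11 (ii)(iii) comparison data
`(E, φ, β)` RELATIVE to the base binders `hdom/hfix/hram` on both sides; `PadicFieldwiseSaturatedTemperedBase.lean`
(`PadicFrd.temperedBase_hdom/_hfix/_hram`) and `PadicFieldwiseSaturatedGaloisBase.lean` (`PadicFrd.galoisCosetBase_*`)
discharged those binders for the printed §2 bases `B^temp(Π, Π°)⁰ → B^temp(G_{ℚ_p})⁰ → D₀` (resp. their case `Π = G_{ℚ_p}`).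
THIS FILE composes the two: the hypothesis `hfs : d₁.IsFieldwiseSaturated ↔ d₂.IsFieldwiseSaturated` of abc-iut-L1-t7's
[FrdII] Thm 2.4 (i) assembly (`Def22Context…thm24i_of…`, `thm24i_ofObjects`) now follows from the `Ψ`-data `(E, φ, β)` ALONE:

* `PadicFrd.Datum.isFieldwiseSaturated_iff_of_equiv_temperedBase` — bases `B^temp(Πᵢ, Πᵢ°)⁰ → D₀` (`Πᵢ` tempered,
  `φᵢ : Πᵢ → G_{ℚ_{pᵢ}}` continuous open, domination-closed `Pᵢ` on `CosetCat Πᵢ`);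
* `PadicFrd.Datum.isFieldwiseSaturated_iff_of_equiv_galoisCosetBase` — bases `B^temp(G_{ℚ_{pᵢ}})⁰ → D₀` on `CosetCat`.

Classical; nothing here bears on [IUTchIII] Cor. 3.12; no statement of the paper is strengthened.
-/

noncomputable section

open CategoryTheory Opposite Function Topology
open Literature.AnabelianGeometry.SemiGraphs

namespace Literature.AlgebraicGeometry.Frobenioids

namespace PadicFrd

namespace Datum

open QuasiTemperoid

variable {p₁ p₂ : ℕ} [Fact p₁.Prime] [Fact p₂.Prime]
  {Γ₁ : Type} [Group Γ₁] [TopologicalSpace Γ₁] {Γ₂ : Type} [Group Γ₂] [TopologicalSpace Γ₂]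
  {φ₁ : Γ₁ →* GalFbar ℚ_[p₁]} (hφ₁ : Continuous φ₁) {ho₁ : IsOpenMap φ₁} (hΓ₁ : IsTempered Γ₁)
  {φ₂ : Γ₂ →* GalFbar ℚ_[p₂]} (hφ₂ : Continuous φ₂) {ho₂ : IsOpenMap φ₂} (hΓ₂ : IsTempered Γ₂)
  {P₁ : ObjectProperty (CosetCat Γ₁)} (hP₁ : ∀ {X Y : CosetCat Γ₁}, (X ⟶ Y) → P₁ Y → P₁ X)
  {P₂ : ObjectProperty (CosetCat Γ₂)} (hP₂ : ∀ {X Y : CosetCat Γ₂}, (X ⟶ Y) → P₂ Y → P₂ X)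

include hφ₁ hΓ₁ hφ₂ hΓ₂ hP₁ hP₂ in
/-- **[FrdII] Thm. 2.4 (i), proof p. 20 ll. 21–28: «Thus, `Φ₁` is fieldwise saturated if and only if `Φ₂` is»** — over the
printed §2 bases `Dᵢ = B^temp(Πᵢ, Πᵢ°)⁰ → B^temp(G_{ℚ_{pᵢ}})⁰ → D₀` (small models), from the [FrdI] Cor. 4.10 / 4.11 (ii)(iii)
data of `Ψ` ALONE: a 1-compatible equivalence `E = Ψ^Base : D₁ ⥲ D₂` and compatible isomorphisms of functors `φ : Φ₁ ⥲ Φ₂`,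
`β : B₁ ⥲ B₂` preserving `O^⊳(−)` (`hβdiv`). No base binders: Galois closures, Galois theory and ramified covers over
both bases are the seat's `temperedBase_hdom/_hfix/_hram`. [cite: MochizukiFrdII2008, Thm 2.4 (i) p.20] -/
theorem isFieldwiseSaturated_iff_of_equiv_temperedBase (d₁ : Datum P₁.FullSubcategory p₁) (d₂ : Datum P₂.FullSubcategory p₂)
    (hd₁ : d₁.base = P₁.ι ⋙ CosetCat.push φ₁ ho₁ ⋙ CosetCat.toConnected (isTempered_galFbar ℚ_[p₁]) ⋙ galoisPadicFields p₁)
    (hd₂ : d₂.base = P₂.ι ⋙ CosetCat.push φ₂ ho₂ ⋙ CosetCat.toConnected (isTempered_galFbar ℚ_[p₂]) ⋙ galoisPadicFields p₂)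
    (E : P₁.FullSubcategory ≌ P₂.FullSubcategory)
    (φ : ∀ X : P₁.FullSubcategory, d₁.Φ.obj (op X) ≃* d₂.Φ.obj (op (E.functor.obj X)))
    (hφ : ∀ ⦃X Y : P₁.FullSubcategory⦄ (f : Y ⟶ X) (x : d₁.Φ.obj (op X)),
      φ Y ((d₁.Φ.map f.op).hom x) = (d₂.Φ.map (E.functor.map f).op).hom (φ X x))
    (β : ∀ X : P₁.FullSubcategory, d₁.B.obj (op X) ≃* d₂.B.obj (op (E.functor.obj X)))
    (hβ : ∀ ⦃X Y : P₁.FullSubcategory⦄ (f : Y ⟶ X) (b : d₁.B.obj (op X)),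
      β Y ((d₁.B.map f.op).hom b) = (d₂.B.map (E.functor.map f).op).hom (β X b))
    (hβdiv : ∀ (X : P₁.FullSubcategory) (b : d₁.B.obj (op X)),
      Frobenioids.divB d₂.Φ d₂.B d₂.divB (op (E.functor.obj X)) (β X b) =
        MonGp.map (φ X).toMonoidHom (Frobenioids.divB d₁.Φ d₁.B d₁.divB (op X) b)) :
    d₁.IsFieldwiseSaturated ↔ d₂.IsFieldwiseSaturated := by
  obtain ⟨base₁, hloc₁, hc₁, he₁, Φ₁, ι₁, hι₁, hmono₁, B₁, toB0₁, divB₁, sq₁, cart₁, nz₁⟩ := d₁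
  obtain ⟨base₂, hloc₂, hc₂, he₂, Φ₂, ι₂, hι₂, hmono₂, B₂, toB0₂, divB₂, sq₂, cart₂, nz₂⟩ := d₂
  cases hd₁
  cases hd₂
  exact isFieldwiseSaturated_iff_of_equiv' _ _ E φ hφ β hβ hβdiv
    (fun ⦃B C : P₁.FullSubcategory⦄ (_ : B ⟶ C) => B.obj.sg.toSubgroup.Normal)
    (fun ⦃B C : P₂.FullSubcategory⦄ (_ : B ⟶ C) => B.obj.sg.toSubgroup.Normal)
    (temperedBase_hdom hΓ₁ P₁ hP₁) (temperedBase_hfix p₁ φ₁ ho₁ P₁) (temperedBase_hram p₁ φ₁ hφ₁ ho₁ P₁ hP₁)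
    (temperedBase_hdom hΓ₂ P₂ hP₂) (temperedBase_hfix p₂ φ₂ ho₂ P₂) (temperedBase_hram p₂ φ₂ hφ₂ ho₂ P₂ hP₂)

omit hφ₁ hΓ₁ hφ₂ hΓ₂ hP₁ hP₂ in
/-- **The same over the bases `B^temp(G_{ℚ_{pᵢ}})⁰ → D₀`** on the small coset categories (the case `Πᵢ = G_{ℚ_{pᵢ}}`,
`Πᵢ° = Πᵢ`; binders from `PadicFieldwiseSaturatedGaloisBase.lean`): «`Φ₁` is fieldwise saturated if and only if `Φ₂` is»
from `(E, φ, β)` alone. [cite: MochizukiFrdII2008, Thm 2.4 (i) p.20] -/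
theorem isFieldwiseSaturated_iff_of_equiv_galoisCosetBase (d₁ : Datum (CosetCat (GalFbar ℚ_[p₁])) p₁)
    (d₂ : Datum (CosetCat (GalFbar ℚ_[p₂])) p₂)
    (hd₁ : d₁.base = CosetCat.toConnected (isTempered_galFbar ℚ_[p₁]) ⋙ galoisPadicFields p₁)
    (hd₂ : d₂.base = CosetCat.toConnected (isTempered_galFbar ℚ_[p₂]) ⋙ galoisPadicFields p₂)
    (E : CosetCat (GalFbar ℚ_[p₁]) ≌ CosetCat (GalFbar ℚ_[p₂]))
    (φ : ∀ X : CosetCat (GalFbar ℚ_[p₁]), d₁.Φ.obj (op X) ≃* d₂.Φ.obj (op (E.functor.obj X)))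
    (hφ : ∀ ⦃X Y : CosetCat (GalFbar ℚ_[p₁])⦄ (f : Y ⟶ X) (x : d₁.Φ.obj (op X)),
      φ Y ((d₁.Φ.map f.op).hom x) = (d₂.Φ.map (E.functor.map f).op).hom (φ X x))
    (β : ∀ X : CosetCat (GalFbar ℚ_[p₁]), d₁.B.obj (op X) ≃* d₂.B.obj (op (E.functor.obj X)))
    (hβ : ∀ ⦃X Y : CosetCat (GalFbar ℚ_[p₁])⦄ (f : Y ⟶ X) (b : d₁.B.obj (op X)),
      β Y ((d₁.B.map f.op).hom b) = (d₂.B.map (E.functor.map f).op).hom (β X b))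
    (hβdiv : ∀ (X : CosetCat (GalFbar ℚ_[p₁])) (b : d₁.B.obj (op X)),
      Frobenioids.divB d₂.Φ d₂.B d₂.divB (op (E.functor.obj X)) (β X b) =
        MonGp.map (φ X).toMonoidHom (Frobenioids.divB d₁.Φ d₁.B d₁.divB (op X) b)) :
    d₁.IsFieldwiseSaturated ↔ d₂.IsFieldwiseSaturated := by
  obtain ⟨base₁, hloc₁, hc₁, he₁, Φ₁, ι₁, hι₁, hmono₁, B₁, toB0₁, divB₁, sq₁, cart₁, nz₁⟩ := d₁
  obtain ⟨base₂, hloc₂, hc₂, he₂, Φ₂, ι₂, hι₂, hmono₂, B₂, toB0₂, divB₂, sq₂, cart₂, nz₂⟩ := d₂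
  cases hd₁
  cases hd₂
  exact isFieldwiseSaturated_iff_of_equiv' _ _ E φ hφ β hβ hβdiv
    (fun ⦃B C : CosetCat (GalFbar ℚ_[p₁])⦄ (_ : B ⟶ C) => B.sg.toSubgroup.Normal)
    (fun ⦃B C : CosetCat (GalFbar ℚ_[p₂])⦄ (_ : B ⟶ C) => B.sg.toSubgroup.Normal)
    (galoisCosetBase_hdom p₁) (galoisCosetBase_hfix p₁) (galoisCosetBase_hram p₁)
    (galoisCosetBase_hdom p₂) (galoisCosetBase_hfix p₂) (galoisCosetBase_hram p₂)

end Datum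

end PadicFrd

end Literature.AlgebraicGeometry.Frobenioids

end
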